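import Summits.QuantumAdvantage.QuantumAdvantage.Theorems.CertDialP
import HarnessLib

/-!
# CertDial — part Q (§15d–f): PLACING THE TWO BLOCKS — the weight-5 light law for ALL answer maps of BOUNDED FAN-IN, and its sharpness

§15d.  Conjugating an answer map by a rotation (`conjRot t z : x ↦ rot t (z (rot (n-t) x))`) moves the two blocks of part P to
`{t,t+1,t+2}` and `{t+a,t+a+1,t+a+2}`; wins and light odd-class losses are transported by the tree's `rel_rot` / `card_filter_shift`
(`rel_conjRot`, `lightLoss_of_conjRot`).
§15e.  ★★★ `juntaLightLaw_five` — THE WEIGHT-5 JUNTA LAW: on an even ring with `18J² + 12J + 6 ≤ n`, EVERY answer map each of whose rows depends on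
at most `J` input positions (`HasFanIn J z` — arbitrary read-sets, arbitrary tables, no geometry, no degree bound) loses an odd-class input of
weight `≤ 5`.  Proof: a placement `(t, q = t + a)` (`a` odd, `3 ≤ a ≤ n-3`; there are `n(n-4)/2`) is BAD for row `c` with read-set `R_c` iff `R_c` meets both
blocks, or `c = q+1` and `R_c` meets the near block, or `c = t+1` and `R_c` meets the far block; each row spoils at most `9J² + 6J` placements
(`card_bad_le`: explicit images of `R_c × R_c × 3 × 3`, `R_c × 3`, `R_c × 3`), so some placement is good for every row, and then the conjugate
`conjRot t z` is two-block-local for `a` (rows not reading the far block have the near view, etc.), hence loses one of the nine inputs of `T9(a)` by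
part P.  Strategy form `juntaLightFail_five` (every strategy of fan-in `≤ J`, ANY degree).  §15f: contraposed — weight-5-perfect play has fan-in `> J`
(`perfectFive_not_hasFanInStrat`); NODE «LightDial»'s quadratic count-reading strategy `predW` (perfect to weight 5 at every even `n ≥ 4`) is the
kernel witness that the boundary «bounded reads | global counts» is sharp (`predW_not_hasFanInStrat`).  The census seat's count (K55 §B: `n₀(J) ≤ 9J²+6J+8` with all
gaps `a`) is halved here to odd gaps for a shorter proof.  Imports part P.  Nothing here touches 27432.
`lean check` on the tree closure: rc 0, no warnings, no placeholders; axioms standard (`propext`, `Classical.choice`, `Quot.sound`).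
-/

set_option linter.dupNamespace false
set_option linter.style.longLine false

noncomputable section
open scoped Classical

namespace Summit.QuantumAdvantage.QuantumAdvantage.Theorems.CertDial
open Finset
open Literature.Computability.QuantumComplexity Literature.Computability.QuantumComplexity.RingHLF
open Summit.QuantumAdvantage.AdviceFreeQNC0
open Literature.Computability.MetaComplexity Literature.Computability.MetaComplexity.Smolensky
open Summit.QuantumAdvantage.AdviceFreeQNC0.RingSymmetry (shift rot_apply rel_rot card_filter_shift shift_shift rot_rot rot_mul_self)

variable {n : ℕ}

/-! ### §15d Conjugation by a rotation -/

/-- the conjugate of an answer map by the rotation `t`: `x ↦ rot t (z (rot (n - t) x))` (the map `z` seen from position `t`). -/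
def conjRot (t : ℕ) (z : (Fin n → Bool) → Fin n → Bool) : (Fin n → Bool) → Fin n → Bool := fun x => rot t (z (rot (n - t) x))

/-- rotations preserve the odd class and the weight. -/
theorem light_rot (k : ℕ) (x : Fin n → Bool) : (OddZeros (rot k x) ↔ OddZeros x) ∧ LightDial.wt (rot k x) = LightDial.wt x := by
  unfold OddZeros LightDial.wt
  simp only [rot_apply]
  rw [card_filter_shift k (fun b : Fin n => x b = false), card_filter_shift k (fun b : Fin n => x b = true)]
  exact ⟨Iff.rfl, rfl⟩

/-- wins of the conjugate are wins of the map on the rotated input (`t ≤ n`). -/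
theorem rel_conjRot {t : ℕ} (ht : t ≤ n) (z : (Fin n → Bool) → Fin n → Bool) (x : Fin n → Bool) :
    Rel x (conjRot t z x) ↔ Rel (rot (n - t) x) (z (rot (n - t) x)) := by
  have h := rel_rot t (rot (n - t) x) (z (rot (n - t) x))
  rw [rot_rot, show t + (n - t) = n * 1 by omega, rot_mul_self] at h
  exact h

/-- transport: if the conjugate loses a light odd-class input, so does the map. -/
theorem lightLoss_of_conjRot {t : ℕ} (ht : t ≤ n) {z : (Fin n → Bool) → Fin n → Bool}
    (h : ∃ x : Fin n → Bool, OddZeros x ∧ LightDial.wt x ≤ 5 ∧ ¬ Rel x (conjRot t z x)) :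
    ∃ x : Fin n → Bool, OddZeros x ∧ LightDial.wt x ≤ 5 ∧ ¬ Rel x (z x) := by
  obtain ⟨x, ho, hw, hr⟩ := h
  exact ⟨rot (n - t) x, (light_rot _ x).1.2 ho, by rw [(light_rot _ x).2]; exact hw, fun hrel => hr ((rel_conjRot ht z x).2 hrel)⟩

/-- `shift` by `n` is the identity. -/
theorem shift_n (b : Fin n) : shift n n b = b := Fin.ext (by rw [val_shift, Nat.add_mod_right, Nat.mod_eq_of_lt b.isLt])

/-- `shift` is symmetric in its two ring arguments: `u + v = v + u`. -/
theorem shift_comm (u v : Fin n) : shift n (u : ℕ) v = shift n (v : ℕ) u := Fin.ext (by rw [val_shift, val_shift, Nat.add_comm])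

/-- shifting back by `t` and forth again. -/
theorem shift_t_sub (t d : Fin n) : shift n (t : ℕ) (shift n (n - (t : ℕ)) d) = d := by
  rw [shift_shift, Nat.sub_add_cancel (le_of_lt t.isLt), shift_n]

/-- a value below `2n` reduced mod `n`. -/
theorem mod_cases_of_lt_two {v : ℕ} (hv : v < 2 * n) : v % n = v ∨ v % n + n = v := by
  rcases Nat.lt_or_ge v n with h | h
  · exact Or.inl (Nat.mod_eq_of_lt h)
  · right
    rw [show v = (v - n) + n from by omega, Nat.add_mod_right, Nat.mod_eq_of_lt (by omega)]

/-! ### §15e Fan-in, bad placements, and the junta law -/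

/-- FAN-IN `≤ J`: every row's answer depends on at most `J` input positions (some read-set `R_b`, `|R_b| ≤ J`; tables arbitrary). -/
def HasFanIn (J : ℕ) (z : (Fin n → Bool) → Fin n → Bool) : Prop :=
  ∀ b : Fin n, ∃ R : Finset (Fin n), R.card ≤ J ∧ ∀ x x' : Fin n → Bool, (∀ d ∈ R, x d = x' d) → z x b = z x' b

/-- a read-set MEETS the block `{s, s+1, s+2}`. -/
def Meets (R : Finset (Fin n)) (s : Fin n) : Prop := ∃ p ∈ R, ∃ i : ℕ, i ≤ 2 ∧ p = shift n i s

/-- the placement (near block at `t`, far block at `q`) is BAD for row `c` with read-set `R`: `R` meets both blocks, or `c = q + 1` and `R` meets the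
near block, or `c = t + 1` and `R` meets the far block. -/
def Bad (R : Finset (Fin n)) (c : Fin n) (tq : Fin n × Fin n) : Prop :=
  (Meets R tq.1 ∧ Meets R tq.2) ∨ (c = shift n 1 tq.2 ∧ Meets R tq.1) ∨ (c = shift n 1 tq.1 ∧ Meets R tq.2)

/-- undoing a shift: `p = s + i ⇒ s = p + (n - i)`. -/
theorem eq_shift_sub {i : ℕ} (hi : i ≤ n) {p s : Fin n} (h : p = shift n i s) : s = shift n (n - i) p := by
  rw [h, shift_sub_shift hi]

/-- ★ each row spoils at most `9J² + 6J` placements. -/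
theorem card_bad_le (hn : 3 ≤ n) {J : ℕ} {R : Finset (Fin n)} (hR : R.card ≤ J) (c : Fin n) :
    (univ.filter fun tq : Fin n × Fin n => Bad R c tq).card ≤ 9 * J ^ 2 + 6 * J := by
  obtain ⟨S₁, hS₁⟩ : ∃ S : Finset (Fin n × Fin n), S = ((R ×ˢ R) ×ˢ (univ : Finset (Fin 3 × Fin 3))).image
      (fun e : (Fin n × Fin n) × (Fin 3 × Fin 3) => (shift n (n - (e.2.1 : ℕ)) e.1.1, shift n (n - (e.2.2 : ℕ)) e.1.2)) := ⟨_, rfl⟩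
  obtain ⟨S₂, hS₂⟩ : ∃ S : Finset (Fin n × Fin n), S = (R ×ˢ (univ : Finset (Fin 3))).image
      (fun e : Fin n × Fin 3 => (shift n (n - (e.2 : ℕ)) e.1, shift n (n - 1) c)) := ⟨_, rfl⟩
  obtain ⟨S₃, hS₃⟩ : ∃ S : Finset (Fin n × Fin n), S = (R ×ˢ (univ : Finset (Fin 3))).image
      (fun e : Fin n × Fin 3 => (shift n (n - 1) c, shift n (n - (e.2 : ℕ)) e.1)) := ⟨_, rfl⟩
  have hsub : (univ.filter fun tq : Fin n × Fin n => Bad R c tq) ⊆ S₁ ∪ S₂ ∪ S₃ := by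
    intro tq htq
    rw [Finset.mem_filter] at htq
    obtain ⟨t, q⟩ := tq
    rcases htq.2 with ⟨⟨p, hp, i, hi, hpi⟩, ⟨p', hp', j, hj, hpj⟩⟩ | ⟨hc, ⟨p, hp, i, hi, hpi⟩⟩ | ⟨hc, ⟨p', hp', j, hj, hpj⟩⟩
    · rw [hS₁]
      refine Finset.mem_union_left _ (Finset.mem_union_left _ (Finset.mem_image.2 ⟨((p, p'), (⟨i, by omega⟩, ⟨j, by omega⟩)),
        Finset.mem_product.2 ⟨Finset.mem_product.2 ⟨hp, hp'⟩, Finset.mem_univ _⟩, ?_⟩))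
      simp only
      rw [← eq_shift_sub (by omega) hpi, ← eq_shift_sub (by omega) hpj]
    · rw [hS₂]
      refine Finset.mem_union_left _ (Finset.mem_union_right _ (Finset.mem_image.2 ⟨(p, ⟨i, by omega⟩),
        Finset.mem_product.2 ⟨hp, Finset.mem_univ _⟩, ?_⟩))
      simp only
      rw [← eq_shift_sub (by omega) hpi, ← eq_shift_sub (by omega) hc]
    · rw [hS₃]
      refine Finset.mem_union_right _ (Finset.mem_image.2 ⟨(p', ⟨j, by omega⟩), Finset.mem_product.2 ⟨hp', Finset.mem_univ _⟩, ?_⟩)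
      simp only
      rw [← eq_shift_sub (by omega) hpj, ← eq_shift_sub (by omega) hc]
  have h9 : (univ : Finset (Fin 3 × Fin 3)).card = 9 := by simp
  have h3 : (univ : Finset (Fin 3)).card = 3 := by simp
  have hRR := Nat.mul_le_mul hR hR
  have c₁ : S₁.card ≤ 9 * J ^ 2 := by
    rw [hS₁, pow_two]
    refine Finset.card_image_le.trans ?_
    rw [Finset.card_product, Finset.card_product, h9]
    omega
  have c₂ : S₂.card ≤ 3 * J := by rw [hS₂]; refine Finset.card_image_le.trans ?_; rw [Finset.card_product, h3]; omega
  have c₃ : S₃.card ≤ 3 * J := by rw [hS₃]; refine Finset.card_image_le.trans ?_; rw [Finset.card_product, h3]; omega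
  have hu₁ := Finset.card_union_le (S₁ ∪ S₂) S₃
  have hu₂ := Finset.card_union_le S₁ S₂
  exact (Finset.card_le_card hsub).trans (by omega)

/-- ★★★ THE WEIGHT-5 JUNTA LAW.  On an even ring with `18J² + 12J + 6 ≤ n`, every answer map of fan-in `≤ J` loses an odd-class input of weight `≤ 5`. -/
theorem juntaLightLaw_five (J : ℕ) (he : n % 2 = 0) (hn : 18 * J ^ 2 + 12 * J + 6 ≤ n) (z : (Fin n → Bool) → Fin n → Bool)
    (hz : HasFanIn J z) : ∃ x : Fin n → Bool, OddZeros x ∧ LightDial.wt x ≤ 5 ∧ ¬ Rel x (z x) := by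
  choose R hRJ hRdep using hz
  -- the placements `(t, t + a)`, `a = 2m + 3`, `2m + 6 ≤ n`
  obtain ⟨Pl, hPl⟩ : ∃ S : Finset (Fin n × Fin n), S = ((univ : Finset (Fin n)) ×ˢ (univ.filter fun m : Fin n => 2 * (m : ℕ) + 6 ≤ n)).image
      (fun tm : Fin n × Fin n => (tm.1, shift n (2 * (tm.2 : ℕ) + 3) tm.1)) := ⟨_, rfl⟩
  -- the bad ones
  obtain ⟨U, hU⟩ : ∃ S : Finset (Fin n × Fin n), S = univ.biUnion fun c : Fin n => univ.filter fun tq : Fin n × Fin n => Bad (R c) c tq :=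
    ⟨_, rfl⟩
  have hPlcard : Pl.card = n * ((n - 4) / 2) := by
    rw [hPl, Finset.card_image_of_injOn, Finset.card_product, Finset.card_univ, Fintype.card_fin]
    · congr 1
      rw [Finset.filter_congr fun (m : Fin n) _ => show (2 * (m : ℕ) + 6 ≤ n) ↔ (m : ℕ) < (n - 4) / 2 by omega, Fin.card_filter_val_lt]
      omega
    · intro tm htm tm' htm' h
      have hm : 2 * (tm.2 : ℕ) + 6 ≤ n := (Finset.mem_filter.1 (Finset.mem_product.1 (Finset.mem_coe.1 htm)).2).2
      have hm' : 2 * (tm'.2 : ℕ) + 6 ≤ n := (Finset.mem_filter.1 (Finset.mem_product.1 (Finset.mem_coe.1 htm')).2).2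
      simp only [Prod.mk.injEq] at h
      obtain ⟨h1, h2⟩ := h
      have hv := congrArg Fin.val h2
      rw [val_shift, val_shift, h1] at hv
      have := tm.2.isLt; have := tm'.2.isLt; have := tm'.1.isLt
      refine Prod.ext h1 (Fin.ext ?_)
      rcases mod_cases_of_lt_two (n := n) (v := (tm'.1 : ℕ) + (2 * (tm.2 : ℕ) + 3)) (by omega) with e | e <;>
        rcases mod_cases_of_lt_two (n := n) (v := (tm'.1 : ℕ) + (2 * (tm'.2 : ℕ) + 3)) (by omega) with e' | e' <;> omega
  have hUcard : U.card ≤ n * (9 * J ^ 2 + 6 * J) := by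
    rw [hU]
    refine Finset.card_biUnion_le.trans ((Finset.sum_le_card_nsmul _ _ (9 * J ^ 2 + 6 * J) fun c _ => card_bad_le (by omega) (hRJ c) c).trans ?_)
    rw [Finset.card_univ, Fintype.card_fin, smul_eq_mul]
  have hK : 9 * J ^ 2 + 6 * J + 1 ≤ (n - 4) / 2 := by omega
  have h1 := Nat.mul_le_mul_left n hK
  rw [mul_add_one] at h1
  have hlt : U.card < Pl.card := by rw [hPlcard]; omega
  obtain ⟨tq, htqPl, htqU⟩ := Finset.exists_mem_notMem_of_card_lt_card hlt
  rw [hPl] at htqPl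
  obtain ⟨⟨t, m⟩, htm, rfl⟩ := Finset.mem_image.1 htqPl
  have hm : 2 * (m : ℕ) + 6 ≤ n := (Finset.mem_filter.1 (Finset.mem_product.1 htm).2).2
  obtain ⟨a, ha⟩ : ∃ a : ℕ, a = 2 * (m : ℕ) + 3 := ⟨_, rfl⟩
  simp only [← ha] at htqU
  have ht := t.isLt
  have hgood : ∀ c : Fin n, ¬ Bad (R c) c (t, shift n a t) := fun c hb =>
    htqU (by rw [hU]; exact Finset.mem_biUnion.2 ⟨c, Finset.mem_univ c, Finset.mem_filter.2 ⟨Finset.mem_univ _, hb⟩⟩)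
  refine lightLoss_of_conjRot (t := (t : ℕ)) (by omega) (twoBlockLightLaw_five he (a := a) (by omega) (by omega) (by omega) (conjRot (t : ℕ) z) ?_)
  intro b
  -- row `b` of the conjugate reads `R (t + b)` shifted back by `t`
  have hread : ∀ x x' : Fin n → Bool, (∀ d' : Fin n, d' ∈ (R (shift n (t : ℕ) b)).image (shift n (n - (t : ℕ))) → x d' = x' d') →
      conjRot (t : ℕ) z x b = conjRot (t : ℕ) z x' b := fun x x' h =>
    hRdep (shift n (t : ℕ) b) (rot (n - (t : ℕ)) x) (rot (n - (t : ℕ)) x') fun d hd => h _ (Finset.mem_image_of_mem _ hd)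
  have hnear : ¬ Meets (R (shift n (t : ℕ) b)) (shift n a t) → SeesNear a (conjRot (t : ℕ) z) b := fun hF =>
    seesNear_of_reads hread fun d' hd' => by
      obtain ⟨d, hd, rfl⟩ := Finset.mem_image.1 hd'
      refine ⟨fun h0 => hF ⟨d, hd, 0, by omega, ?_⟩, fun h1 => hF ⟨d, hd, 1, by omega, ?_⟩, fun h2 => hF ⟨d, hd, 2, by omega, ?_⟩⟩
      · rw [shift_shift, Nat.add_zero, ← h0, ← shift_comm t, shift_t_sub]
      · rw [shift_shift, ← h1, ← shift_comm t, shift_t_sub]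
      · rw [shift_shift, ← h2, ← shift_comm t, shift_t_sub]
  have hfar : ¬ Meets (R (shift n (t : ℕ) b)) t → SeesFar a (conjRot (t : ℕ) z) b := fun hN =>
    seesFar_of_reads hread fun d' hd' => by
      obtain ⟨d, hd, rfl⟩ := Finset.mem_image.1 hd'
      refine ⟨fun h0 => hN ⟨d, hd, 0, by omega, ?_⟩, fun h1 => hN ⟨d, hd, 1, by omega, ?_⟩, fun h2 => hN ⟨d, hd, 2, by omega, ?_⟩⟩
      · rw [← h0, ← shift_comm t, shift_t_sub]
      · rw [← h1, ← shift_comm t, shift_t_sub]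
      · rw [← h2, ← shift_comm t, shift_t_sub]
  have hgb := hgood (shift n (t : ℕ) b)
  unfold Bad at hgb
  by_cases hF : Meets (R (shift n (t : ℕ) b)) (shift n a t)
  · right
    refine ⟨hfar fun hN => hgb (Or.inl ⟨hN, hF⟩), fun hb1 => hgb (Or.inr (Or.inr ⟨?_, hF⟩))⟩
    rw [shift_comm, hb1]
  · by_cases hba : (b : ℕ) = a + 1
    · right
      refine ⟨hfar fun hN => hgb (Or.inr (Or.inl ⟨?_, hN⟩)), by omega⟩
      rw [shift_comm, hba, shift_shift]
    · left
      exact ⟨hnear hF, hba⟩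

/-- the strategy version: FAN-IN `≤ J` strategies (each `P_b` depends on at most `J` input positions; ANY degree, ANY tables). -/
def HasFanInStrat (J : ℕ) (P : Fin n → CubeFn (ZMod 3) n) : Prop :=
  ∀ b : Fin n, ∃ R : Finset (Fin n), R.card ≤ J ∧ ∀ x x' : Fin n → Bool, (∀ d ∈ R, x d = x' d) → P b x = P b x'

/-- the answer map of a fan-in-`J` strategy has fan-in `≤ J`. -/
theorem hasFanIn_ans {J : ℕ} {P : Fin n → CubeFn (ZMod 3) n} (hP : HasFanInStrat J P) : HasFanIn J (ans P) := by
  intro b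
  obtain ⟨R, hR, h⟩ := hP b
  exact ⟨R, hR, fun x x' hx => by simp only [ans, h x x' hx]⟩

/-- ★★★ JUNTA LIGHT FAIL at weight 5: on an even ring with `18J² + 12J + 6 ≤ n`, every strategy of fan-in `≤ J` — of any degree — loses an
odd-class input of weight `≤ 5`.  (The generic leaf's strategies have fan-in `n`; this is the calibration of how far «bounded reads» reaches.) -/
theorem juntaLightFail_five (J : ℕ) (he : n % 2 = 0) (hn : 18 * J ^ 2 + 12 * J + 6 ≤ n) (P : Fin n → CubeFn (ZMod 3) n)
    (hP : HasFanInStrat J P) : ∃ x : Fin n → Bool, OddZeros x ∧ LightDial.wt x ≤ 5 ∧ ¬ Rel x (ans P x) :=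
  juntaLightLaw_five J he hn (ans P) (hasFanIn_ans hP)

/-! ### §15f Perfect light play forces unbounded fan-in (the junta law contraposed; the tree's `predW` as the witness that the boundary is sharp) -/

/-- ★ contrapositive: a strategy that answers every odd-class input of weight `≤ 5` correctly on an even ring with `18J² + 12J + 6 ≤ n` has fan-in `> J`
(some row depends on more than `J` input positions).  Fan-in of weight-5-perfect play grows at least like `√(n/18)`. -/
theorem perfectFive_not_hasFanInStrat (J : ℕ) (he : n % 2 = 0) (hn : 18 * J ^ 2 + 12 * J + 6 ≤ n) (P : Fin n → CubeFn (ZMod 3) n)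
    (hperf : ∀ x : Fin n → Bool, OddZeros x → LightDial.wt x ≤ 5 → Rel x (ans P x)) : ¬ HasFanInStrat J P := fun hP => by
  obtain ⟨x, ho, hw, hr⟩ := juntaLightFail_five J he hn P hP
  exact hr (hperf x ho hw)

/-- ★ THE BOUNDARY IS SHARP IN THE TREE: NODE «LightDial»'s explicit QUADRATIC strategy `predW` (g26; `P_b = e_b + 2 e_b o_b + 2[x_{b+1}]` with `e_b`, `o_b` the
numbers of ones on / off the parity class of `b` — it READS TWO GLOBAL COUNTS) is perfect on odd-class inputs of weight `≤ 5` at every even `n ≥ 4`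
(`LightDial.predWPerfect_five`), hence has fan-in `> J` whenever `18J² + 12J + 6 ≤ n`: at weight 5 the line between losing and perfect play is exactly
«bounded reads» | «reads a global count», with kernel witnesses on both sides. -/
theorem predW_not_hasFanInStrat (J : ℕ) (he : n % 2 = 0) (hn : 18 * J ^ 2 + 12 * J + 6 ≤ n) :
    ¬ HasFanInStrat J (LightDial.predW (n := n)) :=
  perfectFive_not_hasFanInStrat J he hn LightDial.predW fun x ho hw => LightDial.predWPerfect_five (Nat.even_iff.2 he) (by omega) x ho hw

/-! ### Axiom audit -/

/-- info: 'Summit.QuantumAdvantage.QuantumAdvantage.Theorems.CertDial.juntaLightLaw_five' depends on axioms: [propext,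
 Classical.choice,
 Quot.sound] -/
#guard_msgs in #print axioms juntaLightLaw_five

/-- info: 'Summit.QuantumAdvantage.QuantumAdvantage.Theorems.CertDial.juntaLightFail_five' depends on axioms: [propext,
 Classical.choice,
 Quot.sound] -/
#guard_msgs in #print axioms juntaLightFail_five

/-- info: 'Summit.QuantumAdvantage.QuantumAdvantage.Theorems.CertDial.predW_not_hasFanInStrat' depends on axioms: [propext,
 Classical.choice,
 Quot.sound] -/
#guard_msgs in #print axioms predW_not_hasFanInStrat

end Summit.QuantumAdvantage.QuantumAdvantage.Theorems.CertDial
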